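import Summits.SmoothPoincare4.SmoothPoincare4.Theorems.DottedCircleRasmussenDcrGapHelperFriendsCarrierTkAux12

/-!
# Helper `helper_friendsCarrier_Tk_endSmoothInverse` of stub `helper_friendsCarrier_Tk` — the end collar, part 6: the inverse formulas are smooth
(item stmt-SmoothPoincare4-16128, route route-SmoothPoincare4-DottedCircleRasmussen)

Continuation of `…TkAux8–12` (end collar, parts 1–5), porting the first half of the section
*Smoothness of the inverse collar* of the tree's `OpenTraceCollar.lean`: the smooth ingredients on
the trace side — the handle radius `α = E(G_k y - 1)`, the collar height `-log ξ(α)`, the drop onto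
`M_k` along the collar flow, the tube coordinates `ι₀ ∘ drop`, the profile arguments — and the
smoothness of the three inverse formulas `ΨRad` (radial region), `ΨTube` (tube region), `ΨFlat` (flat
regime of the handle chart) at the relevant points.

* `contMDiffAt_ΨRad`, `contMDiffAt_ΨTube`, `contMDiffAt_ΨFlat`;
* `helper_friendsCarrier_Tk_endSmoothInverse` — the registered summary (explicit form of the height).

Everything is proved; no named facts, no `sorry`.
References: Kirby (1989), Ch. I §5 [Kirby1989]; the tree's `OpenTraceCollar.lean`, `TraceCollarProfile.lean`.
-/

-- the prescribed namespace `Summit.<P>.<Sub>.…` duplicates `SmoothPoincare4` (P = Sub)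
set_option linter.dupNamespace false
set_option linter.style.longLine false

noncomputable section

open scoped Manifold ContDiff Topology
open Function Set Metric
open Literature.Topology.FourManifolds Literature.Topology.FourManifolds.MMSW

namespace Summit.SmoothPoincare4.SmoothPoincare4.Theorems.DcrGap.MkFriends

namespace FriendsTk

namespace EndDatum

variable {k : ℕ} (E : EndDatum k)

/-! ### Smooth ingredients on the trace side -/

/-- The handle radius `y ↦ E(G_k y - 1)` is smooth on the band (`y ∈ P`, `G_k y > 1 - δ`). [folklore] -/
theorem contDiffAt_radA {y : EuclideanSpace ℝ (Fin 4)} (hy : y ∈ E.hbNbhd) (h1 : 1 < levelFun k y) : ContDiffAt ℝ ∞ E.radA y := by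
  have hG := contDiffAt_levelFun (r := k) (y := y) fun j => (lt_trans (by norm_num) (hy.1 j)).ne'
  have hden : E.δ + (levelFun k y - 1) ≠ 0 := by linarith [E.δ_pos]
  unfold radA TraceDatum.handleRadius
  exact (contDiffAt_const.sub (hG.sub contDiffAt_const)).div (contDiffAt_const.add (hG.sub contDiffAt_const)) hden

/-- The handle radius of a point of `P` off `D_k` lies in `(0, 1)`. [folklore] -/
theorem radA_mem_Ioo {y : EuclideanSpace ℝ (Fin 4)} (hy : y ∈ E.hbNbhd) (h1 : 1 < levelFun k y) : E.radA y ∈ Ioo (0 : ℝ) 1 := by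
  have hs : levelFun k y - 1 ∈ Ioo (-E.δ) E.δ := ⟨by linarith [E.δ_pos], by linarith [hy.2]⟩
  refine ⟨E.handleRadius_pos hs, ?_⟩
  rw [radA, TraceDatum.handleRadius, div_lt_one (by linarith [hs.1])]; linarith

/-- The collar height `y ↦ -log ξ(E(G_k y - 1))` is smooth on `P ∖ D_k`. [folklore] -/
theorem contDiffAt_heightR {y : EuclideanSpace ℝ (Fin 4)} (hy : y ∈ E.hbNbhd) (h1 : 1 < levelFun k y) :
    ContDiffAt ℝ ∞ (fun y : EuclideanSpace ℝ (Fin 4) => -Real.log (TraceCollar.ξ (E.radA y))) y := by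
  obtain ⟨hα, hα1⟩ := E.radA_mem_Ioo hy h1
  have h2 : ContDiffAt ℝ ∞ (fun y : EuclideanSpace ℝ (Fin 4) => TraceCollar.ξ (E.radA y)) y :=
    ContDiffAt.comp (g := TraceCollar.ξ) (f := E.radA) y (TraceCollar.contDiffAt_ξ (by rw [abs_of_pos hα]; exact hα1))
      (E.contDiffAt_radA hy h1)
  exact (h2.log (TraceCollar.ξ_pos hα hα1).ne').neg

/-- The drop `y ↦ θ(1 - G_k y, y)` is smooth on `P`. [folklore] -/
theorem contDiffAt_dropA {y : EuclideanSpace ℝ (Fin 4)} (hy : y ∈ E.hbNbhd) : ContDiffAt ℝ ∞ E.dropA y := by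
  have hG := contDiffAt_levelFun (r := k) (y := y) fun j => (lt_trans (by norm_num) (hy.1 j)).ne'
  unfold dropA
  exact E.contDiff_θ.contDiffAt.comp y ((contDiffAt_const.sub hG).prodMk contDiffAt_id)

/-- The drop of a point of `P` off `D_k` lies on `M_k`, and the point is `θ(G_k y - 1, drop y)`. [folklore] -/
theorem dropA_mem {y : EuclideanSpace ℝ (Fin 4)} (hy : y ∈ E.hbNbhd) (h1 : 1 < levelFun k y) :
    E.dropA y ∈ modelBoundary k ∧ E.θ (levelFun k y - 1, E.dropA y) = y :=
  E.drop_mem_modelBoundary hy.1 ⟨by linarith [E.δ_pos], hy.2⟩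

/-- The tube coordinates `ι₀ ∘ drop` are smooth where the drop is in the open tube `ν₀(𝕊¹ × ℝ²)`. [folklore] -/
theorem contMDiffAt_tubeCoords {y : EuclideanSpace ℝ (Fin 4)} (hy : y ∈ E.hbNbhd) (h1 : 1 < levelFun k y) (h : E.dropA y ∈ range E.ν₀) :
    ContMDiffAt 𝓘(ℝ, EuclideanSpace ℝ (Fin 4)) ((𝓡 1).prod 𝓘(ℝ, EuclideanSpace ℝ (Fin 2))) ∞ (fun y : EuclideanSpace ℝ (Fin 4) => E.ι₀ (E.dropA y)) y := by
  have hmem : E.dropA y ∈ {y : EuclideanSpace ℝ (Fin 4) | (∀ j, (1 : ℝ) / 2 < holeTerm k j y) ∧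
      levelFun k y ∈ Ioo (1 - E.δ) (1 + E.δ) ∧ E.θ (1 - levelFun k y, y) ∈ range E.ν₀} :=
    (E.mem_flowTube₀_iff_of_mem (E.dropA_mem hy h1).1).2 h
  exact (E.contMDiffOn_ι₀.contMDiffAt (E.isOpen_flowTube₀.mem_nhds hmem)).comp y (E.contDiffAt_dropA hy).contMDiffAt

/-- The profile arguments `(ξ(α), log (2/‖w‖))` are smooth. [folklore] -/
theorem contMDiffAt_profArgs {y : EuclideanSpace ℝ (Fin 4)} (hy : y ∈ E.hbNbhd) (h1 : 1 < levelFun k y) (h : E.dropA y ∈ range E.ν₀)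
    (hw : (E.ι₀ (E.dropA y)).2 ≠ 0) :
    ContMDiffAt 𝓘(ℝ, EuclideanSpace ℝ (Fin 4)) 𝓘(ℝ, ℝ × ℝ) ∞ (fun y : EuclideanSpace ℝ (Fin 4) => (TraceCollar.ξ (E.radA y),
      Real.log (2 / ‖(E.ι₀ (E.dropA y)).2‖))) y := by
  obtain ⟨hα, hα1⟩ := E.radA_mem_Ioo hy h1
  have hξ : ContMDiffAt 𝓘(ℝ, EuclideanSpace ℝ (Fin 4)) 𝓘(ℝ, ℝ) ∞ (fun y : EuclideanSpace ℝ (Fin 4) => TraceCollar.ξ (E.radA y)) y := by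
    have ha : ContDiffAt ℝ ∞ (fun y : EuclideanSpace ℝ (Fin 4) => TraceCollar.ξ (E.radA y)) y :=
      ContDiffAt.comp (g := TraceCollar.ξ) (f := E.radA) y (TraceCollar.contDiffAt_ξ (by rw [abs_of_pos hα]; exact hα1))
        (E.contDiffAt_radA hy h1)
    exact ha.contMDiffAt
  have h2 : ContMDiffAt 𝓘(ℝ, EuclideanSpace ℝ (Fin 4)) 𝓘(ℝ, ℝ) ∞
      (fun y : EuclideanSpace ℝ (Fin 4) => Real.log (2 / ‖(E.ι₀ (E.dropA y)).2‖)) y := by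
    have hw' : ContMDiffAt 𝓘(ℝ, EuclideanSpace ℝ (Fin 4)) 𝓘(ℝ, EuclideanSpace ℝ (Fin 2)) ∞ (fun y : EuclideanSpace ℝ (Fin 4) => (E.ι₀ (E.dropA y)).2) y :=
      contMDiffAt_snd.comp y (E.contMDiffAt_tubeCoords hy h1 h)
    have hl : ContDiffAt ℝ ∞ (fun w : EuclideanSpace ℝ (Fin 2) => Real.log (2 / ‖w‖)) (E.ι₀ (E.dropA y)).2 := by
      have hn : ContDiffAt ℝ ∞ (fun w : EuclideanSpace ℝ (Fin 2) => ‖w‖) _ := contDiffAt_norm ℝ hw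
      have hpos' : 0 < ‖(E.ι₀ (E.dropA y)).2‖ := norm_pos_iff.2 hw
      exact ((contDiffAt_const.div hn hpos'.ne').log (div_pos two_pos hpos').ne')
    exact hl.contMDiffAt.comp y hw'
  exact hξ.prodMk_space h2

/-- **The flat inverse formula is smooth** on the flat-regime set of the handle chart, for any solid
torus `jB` smooth on `D̊² × 𝕊¹` (the template's `contMDiffAt_ΨFlat`, generic form). [folklore] -/
theorem contMDiffAt_ΨFlat_of_jBt {Y : Type*} [TopologicalSpace Y] [ChartedSpace (EuclideanSpace ℝ (Fin 3)) Y] {jB : ↥solidTorus → Y}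
    (hjB : ContMDiffOn (𝓘(ℝ, EuclideanSpace ℝ (Fin 2)).prod (𝓡 1)) (𝓡 3) ∞ (TubeNbhd.jBt jB) solidTorus)
    {z : EuclideanSpace ℝ (Fin 2) × EuclideanSpace ℝ (Fin 2)} (hz : z ∈ TubeNbhd.flatSetT) :
    ContMDiffAt 𝓘(ℝ, EuclideanSpace ℝ (Fin 2) × EuclideanSpace ℝ (Fin 2)) ((𝓡 3).prod 𝓘(ℝ, ℝ)) ∞ (TubeNbhd.ΨFlat jB) z := by
  haveI : Fact (Module.finrank ℝ (EuclideanSpace ℝ (Fin 2)) = 1 + 1) := ⟨by simp⟩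
  obtain ⟨hx1, hw, hflat⟩ := hz
  have hw' : OpenPartialHomeomorph.univBall (0 : EuclideanSpace ℝ (Fin 2)) 2 z.2 ≠ 0 := TubeNbhd.univBall_ne_zero hw
  have hr : 0 < TubeNbhd.radF z := norm_pos_iff.2 hw'
  have hr2 : TubeNbhd.radF z < 2 := TubeNbhd.norm_univBall_lt z.2
  have hYy : 0 < Real.log (2 / TubeNbhd.radF z) := Real.log_pos ((lt_div_iff₀ hr).2 (by linarith))
  have hψ : 0 < TraceCollar.ψ (Real.log (2 / TubeNbhd.radF z)) := TraceCollar.ψ_pos hYy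
  have hrad : ContDiffAt ℝ ∞ TubeNbhd.radF z := TubeNbhd.contDiffAt_radF hw
  have hY : ContDiffAt ℝ ∞ (fun z : EuclideanSpace ℝ (Fin 2) × EuclideanSpace ℝ (Fin 2) => Real.log (2 / TubeNbhd.radF z)) z :=
    (contDiffAt_const.div hrad hr.ne').log (div_pos two_pos hr).ne'
  have hψY : ContDiffAt ℝ ∞ (fun z : EuclideanSpace ℝ (Fin 2) × EuclideanSpace ℝ (Fin 2) => TraceCollar.ψ (Real.log (2 / TubeNbhd.radF z))) z :=
    ContDiffAt.comp (g := TraceCollar.ψ) (f := fun z : EuclideanSpace ℝ (Fin 2) × EuclideanSpace ℝ (Fin 2) => Real.log (2 / TubeNbhd.radF z)) z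
      TraceCollar.contDiff_ψ.contDiffAt hY
  have hsq : ContDiffAt ℝ ∞ (fun z : EuclideanSpace ℝ (Fin 2) × EuclideanSpace ℝ (Fin 2) => (1 - ‖z.1‖ ^ 2)⁻¹) z := by
    have h1 : ‖z.1‖ ^ 2 < 1 := by nlinarith [norm_nonneg z.1]
    exact (contDiffAt_const.sub ((contDiff_norm_sq ℝ).contDiffAt.comp z contDiffAt_fst)).inv (by
      simp only [Function.comp_apply]; exact (sub_pos.2 h1).ne')
  have hs : ContDiffAt ℝ ∞ (fun z : EuclideanSpace ℝ (Fin 2) × EuclideanSpace ℝ (Fin 2) =>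
      TubeNbhd.radF z / TraceCollar.ψ (Real.log (2 / TubeNbhd.radF z)) * (1 - ‖z.1‖ ^ 2)⁻¹) z :=
    (hrad.div hψY hψ.ne').mul hsq
  have hp : ContDiffAt ℝ ∞ (fun z : EuclideanSpace ℝ (Fin 2) × EuclideanSpace ℝ (Fin 2) =>
      (TubeNbhd.radF z / TraceCollar.ψ (Real.log (2 / TubeNbhd.radF z)) * (1 - ‖z.1‖ ^ 2)⁻¹) • z.1) z := hs.smul contDiffAt_fst
  have hv : ContMDiffAt 𝓘(ℝ, EuclideanSpace ℝ (Fin 2) × EuclideanSpace ℝ (Fin 2)) (𝓡 1) ∞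
      (fun z : EuclideanSpace ℝ (Fin 2) × EuclideanSpace ℝ (Fin 2) => radialProjection (spherePt 1)
        (OpenPartialHomeomorph.univBall (0 : EuclideanSpace ℝ (Fin 2)) 2 z.2)) z := by
    have hr' : ContMDiffAt 𝓘(ℝ, EuclideanSpace ℝ (Fin 2)) (𝓡 1) ∞ (radialProjection (spherePt 1))
        (OpenPartialHomeomorph.univBall (0 : EuclideanSpace ℝ (Fin 2)) 2 z.2) :=
      (contMDiffOn_radialProjection (spherePt 1)).contMDiffAt (isOpen_ne.mem_nhds hw')
    exact hr'.comp z (((OpenPartialHomeomorph.contDiff_univBall (c := (0 : EuclideanSpace ℝ (Fin 2))) (r := 2)).comp contDiff_snd).contMDiff z)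
  have hpt : ContMDiffAt 𝓘(ℝ, EuclideanSpace ℝ (Fin 2) × EuclideanSpace ℝ (Fin 2)) (𝓘(ℝ, EuclideanSpace ℝ (Fin 2)).prod (𝓡 1)) ∞
      (fun z : EuclideanSpace ℝ (Fin 2) × EuclideanSpace ℝ (Fin 2) =>
        ((TubeNbhd.radF z / TraceCollar.ψ (Real.log (2 / TubeNbhd.radF z)) * (1 - ‖z.1‖ ^ 2)⁻¹) • z.1,
          radialProjection (spherePt 1) (OpenPartialHomeomorph.univBall (0 : EuclideanSpace ℝ (Fin 2)) 2 z.2))) z :=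
    hp.contMDiffAt.prodMk hv
  have hmem : (((TubeNbhd.radF z / TraceCollar.ψ (Real.log (2 / TubeNbhd.radF z)) * (1 - ‖z.1‖ ^ 2)⁻¹) • z.1,
      radialProjection (spherePt 1) (OpenPartialHomeomorph.univBall (0 : EuclideanSpace ℝ (Fin 2)) 2 z.2)) :
        EuclideanSpace ℝ (Fin 2) × Metric.sphere (0 : EuclideanSpace ℝ (Fin 2)) 1) ∈ solidTorus := by
    rw [mem_solidTorus_iff]
    simp only
    have h1 : ‖z.1‖ ^ 2 < 1 := by nlinarith [norm_nonneg z.1]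
    have hinv : 0 < (1 - ‖z.1‖ ^ 2)⁻¹ := inv_pos.2 (by linarith)
    rw [norm_smul, Real.norm_of_nonneg (by positivity), mul_assoc, ← TraceCollar.ξ_eq_mul]
    have hflat' : 2 * TraceCollar.ξ ‖z.1‖ < TraceCollar.ψ (Real.log (2 / TubeNbhd.radF z)) := hflat
    have hq : TraceCollar.ξ ‖z.1‖ / TraceCollar.ψ (Real.log (2 / TubeNbhd.radF z)) < 2⁻¹ := by
      rw [div_lt_iff₀ hψ]; linarith
    calc TubeNbhd.radF z / TraceCollar.ψ (Real.log (2 / TubeNbhd.radF z)) * TraceCollar.ξ ‖z.1‖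
        = TubeNbhd.radF z * (TraceCollar.ξ ‖z.1‖ / TraceCollar.ψ (Real.log (2 / TubeNbhd.radF z))) := by ring
      _ ≤ TubeNbhd.radF z * 2⁻¹ := by gcongr
      _ < 1 := by linarith
  have h1 : ContMDiffAt 𝓘(ℝ, EuclideanSpace ℝ (Fin 2) × EuclideanSpace ℝ (Fin 2)) (𝓡 3) ∞ (fun z : EuclideanSpace ℝ (Fin 2) × EuclideanSpace ℝ (Fin 2) =>
      TubeNbhd.jBt jB (((TubeNbhd.radF z / TraceCollar.ψ (Real.log (2 / TubeNbhd.radF z)) * (1 - ‖z.1‖ ^ 2)⁻¹) • z.1,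
        radialProjection (spherePt 1) (OpenPartialHomeomorph.univBall (0 : EuclideanSpace ℝ (Fin 2)) 2 z.2)))) z :=
    ContMDiffAt.comp (g := TubeNbhd.jBt jB) z (hjB.contMDiffAt (solidTorus.isOpen.mem_nhds hmem)) hpt
  have h2 : ContMDiffAt 𝓘(ℝ, EuclideanSpace ℝ (Fin 2) × EuclideanSpace ℝ (Fin 2)) 𝓘(ℝ, ℝ) ∞
      (fun z : EuclideanSpace ℝ (Fin 2) × EuclideanSpace ℝ (Fin 2) => -Real.log (TraceCollar.ψ (Real.log (2 / TubeNbhd.radF z)))) z :=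
    (hψY.log hψ.ne').neg.contMDiffAt
  exact h1.prodMk h2


namespace SmoothPresentation

variable {E} {Y : Type*} [TopologicalSpace Y] [ChartedSpace (EuclideanSpace ℝ (Fin 3)) Y] (P : E.SmoothPresentation Y)

/-- `jM` is smooth at points of `M_k ∖ K₀`. [folklore] -/
theorem contMDiffAt_jM {a : EuclideanSpace ℝ (Fin 4)} (ha : a ∈ modelBoundary k) (ha' : a ∉ range E.K₀) :
    ContMDiffAt 𝓘(ℝ, EuclideanSpace ℝ (Fin 4)) (𝓡 3) ∞ P.jM a :=
  P.contMDiffOn_jM.contMDiffAt (P.isOpen_W.mem_nhds (P.mem_W a ha ha'))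

/-- `jBt` is smooth on the open solid torus. [folklore] -/
theorem contMDiffOn_jBt : ContMDiffOn (𝓘(ℝ, EuclideanSpace ℝ (Fin 2)).prod (𝓡 1)) (𝓡 3) ∞ (TubeNbhd.jBt P.jB) solidTorus :=
  P.jB_emb.contMDiff.comp_contMDiffOn (TubeNbhd.contMDiffOn_toOpens' (I := 𝓘(ℝ, EuclideanSpace ℝ (Fin 2)).prod (𝓡 1)) solidTorus TubeNbhd.basePtB)

/-- **The radial inverse formula is smooth** at band points off `D_k` whose drop is off the knot. [folklore] -/
theorem contMDiffAt_ΨRad {y : EuclideanSpace ℝ (Fin 4)} (hy : y ∈ E.hbNbhd) (h1 : 1 < levelFun k y) (hc : E.dropA y ∉ range E.K₀) :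
    ContMDiffAt 𝓘(ℝ, EuclideanSpace ℝ (Fin 4)) ((𝓡 3).prod 𝓘(ℝ, ℝ)) ∞ (E.ΨRad P.jM) y := by
  have hdrop := (E.dropA_mem hy h1).1
  have hj : ContMDiffAt 𝓘(ℝ, EuclideanSpace ℝ (Fin 4)) (𝓡 3) ∞ (fun y : EuclideanSpace ℝ (Fin 4) => P.jM (E.dropA y)) y :=
    (P.contMDiffAt_jM hdrop hc).comp y (E.contDiffAt_dropA hy).contMDiffAt
  exact hj.prodMk (E.contDiffAt_heightR hy h1).contMDiffAt

/-- **The tube inverse formula is smooth** at band points off `D_k` whose drop is in the open tube, off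
the knot. [folklore] -/
theorem contMDiffAt_ΨTube {y : EuclideanSpace ℝ (Fin 4)} (hy : y ∈ E.hbNbhd) (h1 : 1 < levelFun k y) (h : E.dropA y ∈ range E.ν₀)
    (hw : (E.ι₀ (E.dropA y)).2 ≠ 0) :
    ContMDiffAt 𝓘(ℝ, EuclideanSpace ℝ (Fin 4)) ((𝓡 3).prod 𝓘(ℝ, ℝ)) ∞ (E.ΨTube P.jM) y := by
  haveI : Fact (Module.finrank ℝ (EuclideanSpace ℝ (Fin 2)) = 1 + 1) := ⟨by simp⟩
  obtain ⟨hα, hα1⟩ := E.radA_mem_Ioo hy h1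
  have hargs := E.contMDiffAt_profArgs hy h1 h hw
  have hX : 0 < TraceCollar.ξ (E.radA y) := TraceCollar.ξ_pos hα hα1
  have hΩ : (TraceCollar.ξ (E.radA y), Real.log (2 / ‖(E.ι₀ (E.dropA y)).2‖)) ∈ TraceCollar.Ωpos := hX
  have hprof : ContMDiffAt 𝓘(ℝ, EuclideanSpace ℝ (Fin 4)) 𝓘(ℝ, ℝ × ℝ) ∞ E.profP y :=
    ContMDiffAt.comp (g := TraceCollar.Φ)
      (f := fun y : EuclideanSpace ℝ (Fin 4) => (TraceCollar.ξ (E.radA y), Real.log (2 / ‖(E.ι₀ (E.dropA y)).2‖)))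
      y (TraceCollar.contDiffAt_Φ (TraceCollar.Ωpos_subset_Ω hΩ)).contMDiffAt hargs
  have hNT : E.profP y ∈ TraceCollar.Quad := TraceCollar.Φ_mem_Quad hΩ
  have hN : 0 < (E.profP y).1 := hNT.1
  have hT : 0 < (E.profP y).2 := hNT.2
  -- second component `-log N`
  have h2 : ContMDiffAt 𝓘(ℝ, EuclideanSpace ℝ (Fin 4)) 𝓘(ℝ, ℝ) ∞ (fun y : EuclideanSpace ℝ (Fin 4) => -Real.log (E.profP y).1) y := by
    have hl : ContDiffAt ℝ ∞ (fun r : ℝ × ℝ => -Real.log r.1) (E.profP y) := (contDiffAt_fst.log hN.ne').neg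
    exact ContMDiffAt.comp (g := fun r : ℝ × ℝ => -Real.log r.1) (f := E.profP) y hl.contMDiffAt hprof
  -- first component `jM (ν₀ (u, T • v̂))`
  have hcoords := E.contMDiffAt_tubeCoords hy h1 h
  have hu : ContMDiffAt 𝓘(ℝ, EuclideanSpace ℝ (Fin 4)) (𝓡 1) ∞ (fun y : EuclideanSpace ℝ (Fin 4) => (E.ι₀ (E.dropA y)).1) y :=
    contMDiffAt_fst.comp y hcoords
  have hv : ContMDiffAt 𝓘(ℝ, EuclideanSpace ℝ (Fin 4)) 𝓘(ℝ, EuclideanSpace ℝ (Fin 2)) ∞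
      (fun y : EuclideanSpace ℝ (Fin 4) => ((radialProjection (spherePt 1) (E.ι₀ (E.dropA y)).2 :
        Metric.sphere (0 : EuclideanSpace ℝ (Fin 2)) 1) : EuclideanSpace ℝ (Fin 2))) y := by
    have hr : ContMDiffAt 𝓘(ℝ, EuclideanSpace ℝ (Fin 2)) (𝓡 1) ∞ (radialProjection (spherePt 1)) (E.ι₀ (E.dropA y)).2 :=
      (contMDiffOn_radialProjection (spherePt 1)).contMDiffAt (isOpen_ne.mem_nhds hw)
    exact (contMDiff_coe_sphere (E := EuclideanSpace ℝ (Fin 2)) (n := 1)).contMDiffAt.comp y (hr.comp y (contMDiffAt_snd.comp y hcoords))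
  have hTm : ContMDiffAt 𝓘(ℝ, EuclideanSpace ℝ (Fin 4)) 𝓘(ℝ, ℝ) ∞ (fun y : EuclideanSpace ℝ (Fin 4) => (E.profP y).2) y :=
    ContMDiffAt.comp (g := fun r : ℝ × ℝ => r.2) (f := E.profP) y contDiffAt_snd.contMDiffAt hprof
  have hfib : ContMDiffAt 𝓘(ℝ, EuclideanSpace ℝ (Fin 4)) 𝓘(ℝ, EuclideanSpace ℝ (Fin 2)) ∞
      (fun y : EuclideanSpace ℝ (Fin 4) => (E.profP y).2 • ((radialProjection (spherePt 1) (E.ι₀ (E.dropA y)).2 :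
        Metric.sphere (0 : EuclideanSpace ℝ (Fin 2)) 1) : EuclideanSpace ℝ (Fin 2))) y :=
    (TubeNbhd.contDiff_smul_pair (EuclideanSpace ℝ (Fin 2))).contMDiff.contMDiffAt.comp y (hTm.prodMk_space hv)
  have hpt : ContMDiffAt 𝓘(ℝ, EuclideanSpace ℝ (Fin 4)) 𝓘(ℝ, EuclideanSpace ℝ (Fin 4)) ∞
      (fun y : EuclideanSpace ℝ (Fin 4) => E.ν₀ ((E.ι₀ (E.dropA y)).1,
        (E.profP y).2 • ((radialProjection (spherePt 1) (E.ι₀ (E.dropA y)).2 :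
          Metric.sphere (0 : EuclideanSpace ℝ (Fin 2)) 1) : EuclideanSpace ℝ (Fin 2)))) y :=
    E.contMDiff_ν₀.contMDiffAt.comp y (hu.prodMk hfib)
  have h1' : ContMDiffAt 𝓘(ℝ, EuclideanSpace ℝ (Fin 4)) (𝓡 3) ∞ (fun y : EuclideanSpace ℝ (Fin 4) => E.ptY P.jM (E.profP y).2
      (E.ι₀ (E.dropA y)).1 (radialProjection (spherePt 1) (E.ι₀ (E.dropA y)).2)) y :=
    (P.contMDiffAt_jM (E.ν₀_mem _) (E.ν₀_smul_not_mem_range hT.ne' _ _)).comp y hpt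
  exact h1'.prodMk h2

/-- **The flat inverse formula is smooth** on the flat-regime set of the handle chart. [folklore] -/
theorem contMDiffAt_ΨFlat {z : EuclideanSpace ℝ (Fin 2) × EuclideanSpace ℝ (Fin 2)} (hz : z ∈ TubeNbhd.flatSetT) :
    ContMDiffAt 𝓘(ℝ, EuclideanSpace ℝ (Fin 2) × EuclideanSpace ℝ (Fin 2)) ((𝓡 3).prod 𝓘(ℝ, ℝ)) ∞ (TubeNbhd.ΨFlat P.jB) z :=
  contMDiffAt_ΨFlat_of_jBt P.contMDiffOn_jBt hz

end SmoothPresentation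

end EndDatum

end FriendsTk

/-- **Helper `helper_friendsCarrier_Tk_endSmoothInverse`** (registered on the crux item; end collar part 6
of stub `helper_friendsCarrier_Tk`): the flat inverse formula `ΨFlat` of the end collar (the template's,
verbatim: `(x, w'') ↦ (jB (p, ŵ), -log ψ(Y))`) is `C^∞` on the flat regime
`{‖x‖ < 1, w'' ≠ 0, 2ξ(‖x‖) < ψ(log(2/‖univBall w''‖))}` of the handle chart, for every smoothly embedded
solid torus `jB` — together with (in this file) the smoothness of the radial and tube inverse formulas
at band points of the trace (Kirby 1989, Ch. I §5). [cite: Kirby1989, Ch. I §5] -/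
theorem helper_friendsCarrier_Tk_endSmoothInverse : ∀ (Y : Type) [TopologicalSpace Y] [ChartedSpace (EuclideanSpace ℝ (Fin 3)) Y] (jB : solidTorus → Y), Manifold.IsSmoothEmbedding (𝓘(ℝ, EuclideanSpace ℝ (Fin 2)).prod (𝓡 1)) (𝓡 3) ((⊤ : ℕ∞) : WithTop ℕ∞) jB → ∀ z : EuclideanSpace ℝ (Fin 2) × EuclideanSpace ℝ (Fin 2), ‖z.1‖ < 1 → z.2 ≠ 0 → 2 * TraceCollar.ξ ‖z.1‖ < TraceCollar.ψ (Real.log (2 / ‖OpenPartialHomeomorph.univBall (0 : EuclideanSpace ℝ (Fin 2)) 2 z.2‖)) → ContMDiffAt 𝓘(ℝ, EuclideanSpace ℝ (Fin 2) × EuclideanSpace ℝ (Fin 2)) ((𝓡 3).prod 𝓘(ℝ, ℝ)) ((⊤ : ℕ∞) : WithTop ℕ∞) (TubeNbhd.ΨFlat jB) z :=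
  fun _ _ _ _ hjB _ h1 h2 h3 => FriendsTk.EndDatum.contMDiffAt_ΨFlat_of_jBt
    (hjB.contMDiff.comp_contMDiffOn (TubeNbhd.contMDiffOn_toOpens' (I := 𝓘(ℝ, EuclideanSpace ℝ (Fin 2)).prod (𝓡 1)) solidTorus TubeNbhd.basePtB))
    ⟨h1, h2, h3⟩

end Summit.SmoothPoincare4.SmoothPoincare4.Theorems.DcrGap.MkFriends

end
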